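import Summits.QuantumFields.YangMills.Theorems.FlatTubeReductionRateTwoZone
import HarnessLib

/-!
# «ratepack-v2» at the record core exponent `s = 1/6`: the core radius `powScale (1/6) β = β^{-1/6}` is rate-admissible, and K1 ⟸ CORE RATE on `{orbitDist < β^{-1/6}}` + SHELL
# (route `FlatTubeReduction`, crux K1 `NearFlatRatioLaw` stmt-QuantumFields-24720; seat `ym-line-ftr-p1` g10; R2b1 RECORD rung — no summit statement is proved here)

Companion of `…RateTwoZone` (p660673) in lane A's `powScale` currency, so that the CORE of the rate twin is literally a `recordChi L (1/6) K M` window (lane A's structural lemmas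
`recordChi_shadow`, `record_structural_inequalities`, `softTubeAdmissible_recordChi'` apply verbatim at `s = 1/6`) and the SHELL is lane A's `InnerShellGainAt L (powScale (1/6)) (powScale (1/40))`:
* `powScale_sixth_sq` — for `β ≥ 1`: `2^{1/3}·(β^{-1/6})² = L·λ_b(L³β)` (both sides cube to `2/β`);
* ★ `coreRadius_admissible_powSixth` — the IMS defect at radius `β^{-1/6}` is `≤ (48·2^{1/3}π²|E|²L²/uniformFloorConst L)·λ_b(L³β)²·(uniform floor)`;
* ★★★★ `nearFlatRatioLaw_of_coreRate_shell_pow` — K1 ⟸ ∀ L ≥ 2: CORE RATE at `k = 1` on `{∃z, orbitDist(τ_zU) < β^{-1/6}}` ∧ `InnerShellGainAt L (powScale (1/6)) (powScale (1/40))`.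
HONEST FRAMING: glue and `rpow` algebra; CORE RATE and SHELL GAIN are OPEN; femto rung R2b1 (RECORD label); not infinite volume, not a gap, not Clay.  No defs, no named facts, no `sorry`.
-/

set_option autoImplicit false

noncomputable section

open MeasureTheory Filter Topology Real
open scoped BigOperators
open Literature.MathematicalPhysics.QuantumFieldTheory
open Literature.MathematicalPhysics.QuantumLattice

namespace Summit.QuantumFields.YangMills.Theorems.FemtoTransferGap.RateTube

open Summit.QuantumFields.YangMills.Theorems.FemtoTransferGap

variable {L : ℕ} [NeZero L]

/-! ## §1 The core radius `β^{-1/6}` against `√λ_b(L³β)` -/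

/-- For `β ≥ 1`: `2^{1/3}·(powScale (1/6) β)² = L·λ_b(L³β)` — both sides are positive and cube to `2/β`. [folklore] -/
theorem powScale_sixth_sq {β : ℝ} (hβ : 1 ≤ β) :
    (2 : ℝ) ^ ((1 : ℝ) / 3) * powScale (1 / 6) β ^ 2 = (L : ℝ) * bareLambda ((L : ℝ) ^ 3 * β) := by
  have hβ0 : 0 < β := by linarith
  have hL0 : (0 : ℝ) < L := by exact_mod_cast Nat.pos_of_ne_zero (NeZero.ne L)
  have hB0 : (0 : ℝ) < (L : ℝ) ^ 3 * β := by positivity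
  have hd : powScale (1 / 6) β = β ^ (-(1 / 6 : ℝ)) := powScale_eq hβ
  have hd0 : 0 < powScale (1 / 6) β := powScale_pos _ _
  have h2 : 0 < (2 : ℝ) ^ ((1 : ℝ) / 3) := Real.rpow_pos_of_pos two_pos _
  have hlam0 : 0 < bareLambda ((L : ℝ) ^ 3 * β) := bareLambda_pos' hB0
  -- cubes
  have hc1 : ((2 : ℝ) ^ ((1 : ℝ) / 3) * powScale (1 / 6) β ^ 2) ^ 3 = 2 / β := by
    have e2 : ((2 : ℝ) ^ ((1 : ℝ) / 3)) ^ 3 = 2 := by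
      rw [← Real.rpow_natCast, ← Real.rpow_mul (by norm_num : (0 : ℝ) ≤ 2)]; norm_num
    have e6 : (powScale (1 / 6) β ^ 2) ^ 3 = β⁻¹ := by
      rw [← pow_mul, hd, ← Real.rpow_natCast, ← Real.rpow_mul hβ0.le]
      norm_num
      exact Real.rpow_neg_one β
    rw [mul_pow, e2, e6, div_eq_mul_inv]
  have hc2 : ((L : ℝ) * bareLambda ((L : ℝ) ^ 3 * β)) ^ 3 = 2 / β := by
    have h := bareLambda_cube hB0
    rw [mul_pow]
    field_simp
    nlinarith [h]
  have hx : 0 ≤ (2 : ℝ) ^ ((1 : ℝ) / 3) * powScale (1 / 6) β ^ 2 := by positivity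
  have hy : 0 ≤ (L : ℝ) * bareLambda ((L : ℝ) ^ 3 * β) := by positivity
  exact (pow_left_inj₀ hx hy (by norm_num : (3 : ℕ) ≠ 0)).mp (hc1.trans hc2.symm)

/-- ★ **The core radius `powScale (1/6)` is rate-admissible**: for `β ≥ 1`, `0 < β^{-1/6}` and the IMS defect at radius `β^{-1/6}` is
`≤ (48·2^{1/3}π²|E|²L²/uniformFloorConst L)·λ_b(L³β)²·(uniformFloorConst L·c_β^{|E|})`. [folklore] -/
theorem coreRadius_admissible_powSixth :
    ∃ β1 : ℝ, ∀ β : ℝ, β1 ≤ β → 0 < powScale (1 / 6) β ∧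
      (1 / 2) * ((Fintype.card (Edge 3 L) : ℝ) ^ 2 * (8 * π / powScale (1 / 6) β) ^ 2 * (3 / β) * latCE L β) ≤
        (48 * (2 : ℝ) ^ ((1 : ℝ) / 3) * π ^ 2 * (Fintype.card (Edge 3 L) : ℝ) ^ 2 * (L : ℝ) ^ 2 / uniformFloorConst L) * bareLambda ((L : ℝ) ^ 3 * β) ^ 2 *
          (uniformFloorConst L * latCE L β) := by
  have hu := uniformFloorConst_pos (L := L)
  have hL0 : (0 : ℝ) < L := by exact_mod_cast Nat.pos_of_ne_zero (NeZero.ne L)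
  refine ⟨1, fun β hβ => ⟨powScale_pos _ _, ?_⟩⟩
  have hβ0 : 0 < β := by linarith
  have hB0 : (0 : ℝ) < (L : ℝ) ^ 3 * β := by positivity
  set d := powScale (1 / 6) β with hdd
  set lam := bareLambda ((L : ℝ) ^ 3 * β) with hlam
  have hd0 : 0 < d := powScale_pos _ _
  have hlam0 : 0 < lam := bareLambda_pos' hB0
  have h2 : 0 < (2 : ℝ) ^ ((1 : ℝ) / 3) := Real.rpow_pos_of_pos two_pos _
  have hCE := (latCE_pos (L := L) hβ0.le).le
  -- `1/d² = 2^{1/3}/(L λ)` and `3/β = (3/2) L³ λ³`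
  have hsq : (2 : ℝ) ^ ((1 : ℝ) / 3) * d ^ 2 = (L : ℝ) * lam := powScale_sixth_sq (L := L) hβ
  have hcube : β * ((L : ℝ) ^ 3 * lam ^ 3) = 2 := by
    have h := bareLambda_cube hB0; rw [← hlam] at h; linear_combination h
  have h3 : 3 / β = 3 / 2 * (L : ℝ) ^ 3 * lam ^ 3 := by
    rw [div_eq_iff hβ0.ne']; linear_combination (-(3 : ℝ) / 2) * hcube
  have h1 : (8 * π / d) ^ 2 = 64 * π ^ 2 * (2 : ℝ) ^ ((1 : ℝ) / 3) / ((L : ℝ) * lam) := by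
    rw [div_pow, mul_pow]
    have hd2 : d ^ 2 = (L : ℝ) * lam / (2 : ℝ) ^ ((1 : ℝ) / 3) := by
      rw [eq_div_iff h2.ne']; linear_combination hsq
    rw [hd2]; field_simp; ring
  rw [h1, h3]
  have e : (1 / 2) * ((Fintype.card (Edge 3 L) : ℝ) ^ 2 * (64 * π ^ 2 * (2 : ℝ) ^ ((1 : ℝ) / 3) / ((L : ℝ) * lam)) * (3 / 2 * (L : ℝ) ^ 3 * lam ^ 3) * latCE L β) =
      (48 * (2 : ℝ) ^ ((1 : ℝ) / 3) * π ^ 2 * (Fintype.card (Edge 3 L) : ℝ) ^ 2 * (L : ℝ) ^ 2 / uniformFloorConst L) * lam ^ 2 * (uniformFloorConst L * latCE L β) := by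
    field_simp
    ring
  rw [e]

/-! ## §2 ★★★★ K1 ⟸ CORE RATE on `{orbitDist < β^{-1/6}}` + SHELL on `(β^{-1/6}, β^{-1/40})` -/

/-- ★★★★ **K1 `NearFlatRatioLaw` ⟸ for every `L ≥ 2`: the CORE RATE at `k = 1` on the eight-copy region of radius `powScale (1/6) β` and lane A's SHELL GAIN
`InnerShellGainAt L (powScale (1/6)) (powScale (1/40))`.** [cite: Luscher1983, §3] -/
theorem nearFlatRatioLaw_of_coreRate_shell_pow
    (hcore : ∀ (L : ℕ) [NeZero L], 2 ≤ L → ∃ C βc : ℝ, ∀ β : ℝ, βc ≤ β →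
      ∀ F : Fin 2 → (GaugeConfig 3 L SU2 → ℝ), (∀ i, IsPhys (F i)) →
        (∀ i U, F i U ≠ 0 → ∃ z : Fin 3 → Bool, orbitDist (TT.twist3 z U) < powScale (1 / 6) β) →
        (∀ a : Fin 2 → ℝ, a ≠ 0 → 0 < l2 (fun U => ∑ i, a i * F i U) (fun U => ∑ i, a i * F i U)) →
          ∃ a : Fin 2 → ℝ, a ≠ 0 ∧
            qform su2Rep β (fun U => ∑ i, a i * F i U) (fun U => ∑ i, a i * F i U) * levelValue su2Rep 1 ((L : ℝ) ^ 3 * β) 0 ≤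
              Real.exp (C * bareLambda ((L : ℝ) ^ 3 * β) ^ 2) * levelValue su2Rep 1 ((L : ℝ) ^ 3 * β) 1 *
                levelValue su2Rep L β 0 * l2 (fun U => ∑ i, a i * F i U) (fun U => ∑ i, a i * F i U))
    (hshell : ∀ (L : ℕ) [NeZero L], 2 ≤ L → InnerShellGainAt L (powScale (1 / 6)) (powScale (1 / 40))) :
    Summit.QuantumFields.YangMills.Theses.FlatTubeReduction.NearFlatRatioLaw :=
  Summit.QuantumFields.YangMills.Theorems.FlatTubeReduction.nearFlatRatioLaw_of_innerRate fun L _ hL =>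
    innerRate_of_core_shell (L := L) 1
      (D := 48 * (2 : ℝ) ^ ((1 : ℝ) / 3) * π ^ 2 * (Fintype.card (Edge 3 L) : ℝ) ^ 2 * (L : ℝ) ^ 2 / uniformFloorConst L)
      (by have := uniformFloorConst_pos (L := L); positivity) coreRadius_admissible_powSixth (hcore L hL) (hshell L hL)

end Summit.QuantumFields.YangMills.Theorems.FemtoTransferGap.RateTube

end
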